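import HarnessLib
import Summits.CriticalPhenomena.PercolationContinuityZ3.Theses.PercBudgetLadder
import Summits.CriticalPhenomena.PercolationContinuityZ3.Theses.PercNonProliferation
import Summits.CriticalPhenomena.PercolationContinuityZ3.Theorems.PercBudgetLadderBudgetTightnessAnnulusSplit

/-!
# Line `few-clusters-split` — ALTERNATIVE skeleton for crux `BudgetTightness` (stmt-CriticalPhenomena-5248)

Strategist s2 (planner-cstrat-stmt-CriticalPhenomena-5248-s2-0, 2026-08-17). This is the crux-strategist DECOMPOSITION
`BudgetTightness ⟸ NonProliferation ∧ FewClustersCutTight` written as a line, because `route edit --split` is refused to this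
seat until its final cycle ("`--split`, `--resplit` are available on a seat's FINAL cycle only", human ruling 2026-08-15) and
`Theorems/` is prover-only: the two children are the two REGISTERED STUBS below (registered additively with `workitem stub-add`,
NOT with `skeleton check`, so the lead's live skeleton pointer `Lines/Sketch.lean` is not overwritten), and the glue is the
kernel-checked `line_composition` / `BudgetTightness_of` (no `sorry` of its own). It does NOT compete with `Lines/Sketch.lean`
for the lead's attention as a proving line — both stubs are open problems (card `Lines/few-clusters-split.md`, census
`STRATEGY-CENSUS.md` Part I §Decomposition D4); it is the machine-readable record of the split, ready to be filed verbatim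
(`children_s2.json` on the item) by whichever seat reaches a final cycle first.

* `stub_nonProliferation` — VERBATIM the existing crux `PercNonProliferation.NonProliferation` (stmt-CriticalPhenomena-4444;
  `stub_nonProliferation_iff` is `Iff.rfl`): the COUNT half, necessary for the crux (landed
  `Theorems.BudgetTightness.nonProliferation_of_budgetTightness : BudgetTightness → NonProliferation`, p106068), false in `d ≥ 7` — the dimension-detecting piece,
  delegated to stmt-4444's own programme (3 routes want it).
* `stub_fewClustersCutTight` — the THROUGHPUT half in its weakest gluable form: `∀ M ε > 0, ∃ K, ∀ᶠ n,
  P_{p_c}(E_M(n) ∧ budget(n,2n) > K) ≤ ε` with `E_M(n)` = stmt-4444's event (at most `M` crossing clusters) and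
  `budget > K` = "no `≤ K` edge closures block `B(n) → ∂ⁱⁿB(2n)` inside `B(2n)`". Plausibly true in EVERY dimension
  (`d = 2`: RSW + BK; `d ≥ 7`: vacuous, `P(E_M) → 0`), false for every `p > p_c`; implied by the landed throughput hypothesis
  CTT of `stub_annulusSplit` (`fewClustersCutTight_of_throughputTight` below, sorry-free) — so it is the WEAKEST registered
  form of the throughput half.
* `line_composition : stub₁-statement → stub₂-statement → BudgetTightness` (sorry-free; = the to-be-landed
  `Theorems/PercBudgetLadderBudgetTightnessSplit.lean`, registered stub `BudgetTightness_of_subs`, evidence on the item) and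
  `BudgetTightness_of : BudgetTightness := line_composition stub_nonProliferation stub_fewClustersCutTight` — concludes the
  crux BY NAME; `lean check`: rc 0, sorries exactly 2 (the two stubs).
-/

noncomputable section

namespace Summit.CriticalPhenomena.PercolationContinuityZ3.Cruxes.BudgetTightness.LineFewClustersSplit

open MeasureTheory Filter Topology
open Literature.Probability.Percolation Literature.Probability.LatticeModels
open Summit.CriticalPhenomena.PercolationContinuityZ3.Theses.PercBudgetLadder (BudgetTightness)
open Summit.CriticalPhenomena.PercolationContinuityZ3.Theses.PercNonProliferation (NonProliferation)
open Summit.CriticalPhenomena.PercolationContinuityZ3.Theorems.BudgetTightness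

/-! ## The two stubs (= the two children of the split) -/

/-- **STUB 1 (COUNT half) — VERBATIM stmt-CriticalPhenomena-4444 `PercNonProliferation.NonProliferation`.** At `p_c(ℤ³)`
there are `M` and `c > 0` such that for infinitely many `n`, with probability `≥ c` the box `B(n)` contains no `M+1` vertices
each joined to `∂ⁱⁿB(2n)` inside `B(2n)` and pairwise not joined inside `B(2n)`. Open problem (hyperscaling count, `d < 6`);
delegated to stmt-4444's programme — do NOT work it from this line. -/
theorem stub_nonProliferation :
    ∃ (M : ℕ) (c : ℝ), 0 < c ∧ ∃ᶠ n : ℕ in Filter.atTop, c ≤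
      (bondPercolation (zdGraph 3) (criticalProbI 3)).real
        {ω | ¬ ∃ x : Fin (M + 1) → Site 3, (∀ i, x i ∈ box 3 n) ∧
          (∀ i, ∃ y ∈ innerBoundary (zdGraph 3) (box 3 (2 * n)),
            ω ∈ openConnIn ↑(box 3 (2 * n)) (x i) y) ∧
          ∀ i j, i ≠ j → ω ∉ openConnIn ↑(box 3 (2 * n)) (x i) (x j)} := by
  sorry

/-- **STUB 2 (THROUGHPUT half, weakest gluable form) — `FewClustersCutTight`.** For every `M` and `ε > 0` there is a budget
`K` such that for all large `n`, `P_{p_c(ℤ³)}(at most M crossing clusters of B(n) → ∂ⁱⁿB(2n) [stmt-4444's event] ∧ the open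
crossings cannot all be destroyed by closing ≤ K edges) ≤ ε`. Open problem ("a critical crossing cluster is thin"); plausibly
true in every `d`, false for `p > p_c`. -/
theorem stub_fewClustersCutTight :
    ∀ (M : ℕ) (ε : ℝ), 0 < ε → ∃ K : ℕ, ∀ᶠ n : ℕ in Filter.atTop,
      (bondPercolation (zdGraph 3) (criticalProbI 3)).real
        {ω | (¬ ∃ x : Fin (M + 1) → Site 3, (∀ i, x i ∈ box 3 n) ∧
            (∀ i, ∃ y ∈ innerBoundary (zdGraph 3) (box 3 (2 * n)),
              ω ∈ openConnIn ↑(box 3 (2 * n)) (x i) y) ∧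
            ∀ i j, i ≠ j → ω ∉ openConnIn ↑(box 3 (2 * n)) (x i) (x j)) ∧
          ¬ ∃ S : Finset (Sym2 (Site 3)), S.card ≤ K ∧
            ¬ ∃ x ∈ box 3 n, ∃ y ∈ innerBoundary (zdGraph 3) (box 3 (2 * n)),
              (ω \ ↑S) ∈ openConnIn ↑(box 3 (2 * n)) x y} ≤ ε := by
  sorry

/-! ## Calibration of the stubs against the tree (sorry-free) -/

/-- Stub 1 IS stmt-4444's decl, definitionally. -/
theorem stub_nonProliferation_iff :
    (∃ (M : ℕ) (c : ℝ), 0 < c ∧ ∃ᶠ n : ℕ in Filter.atTop, c ≤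
      (bondPercolation (zdGraph 3) (criticalProbI 3)).real
        {ω | ¬ ∃ x : Fin (M + 1) → Site 3, (∀ i, x i ∈ box 3 n) ∧
          (∀ i, ∃ y ∈ innerBoundary (zdGraph 3) (box 3 (2 * n)),
            ω ∈ openConnIn ↑(box 3 (2 * n)) (x i) y) ∧
          ∀ i j, i ≠ j → ω ∉ openConnIn ↑(box 3 (2 * n)) (x i) (x j)}) ↔ NonProliferation :=
  Iff.rfl

/-- **Stub 2 is the WEAKEST registered form of the throughput half**: it follows from the throughput hypothesis CTT of the
landed `stub_annulusSplit` (uniform tightness of the maximal per-cluster throughput, p147728) — on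
`E_M ∩ {every cluster throughput ≤ K'}` the budget is `≤ M·K'` (`AnnulusSplit.minCut_le_of_reps_of_throughput`), so
`E_M ∩ {budget > M·K'} ⊆ {some throughput > K'}`. -/
theorem fewClustersCutTight_of_throughputTight
    (hCT : ∀ ε : ℝ, 0 < ε → ∃ K : ℕ, ∀ᶠ n : ℕ in atTop,
      (bondPercolation (zdGraph 3) (criticalProbI 3)).real
        {ω | ∃ x ∈ box 3 n, (K : ℕ∞) <
          minOpenCutIn (↑(box 3 (2 * n)) : Set (Site 3))
            {a | a ∈ box 3 n ∧ ω ∈ openConnIn (↑(box 3 (2 * n)) : Set (Site 3)) x a}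
            (↑(innerBoundary (zdGraph 3) (box 3 (2 * n))) : Set (Site 3)) ω} ≤ ε) :
    ∀ (M : ℕ) (ε : ℝ), 0 < ε → ∃ K : ℕ, ∀ᶠ n : ℕ in Filter.atTop,
      (bondPercolation (zdGraph 3) (criticalProbI 3)).real
        {ω | (¬ ∃ x : Fin (M + 1) → Site 3, (∀ i, x i ∈ box 3 n) ∧
            (∀ i, ∃ y ∈ innerBoundary (zdGraph 3) (box 3 (2 * n)),
              ω ∈ openConnIn ↑(box 3 (2 * n)) (x i) y) ∧
            ∀ i j, i ≠ j → ω ∉ openConnIn ↑(box 3 (2 * n)) (x i) (x j)) ∧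
          ¬ ∃ S : Finset (Sym2 (Site 3)), S.card ≤ K ∧
            ¬ ∃ x ∈ box 3 n, ∃ y ∈ innerBoundary (zdGraph 3) (box 3 (2 * n)),
              (ω \ ↑S) ∈ openConnIn ↑(box 3 (2 * n)) x y} ≤ ε := by
  intro M ε hε
  obtain ⟨K', hK'⟩ := hCT ε hε
  refine ⟨M * K', hK'.mono fun n hn => le_trans (measureReal_mono ?_ (measure_ne_top _ _)) hn⟩
  rintro ω ⟨hE, hbudget⟩
  by_contra hno
  -- every cluster throughput ≤ K' on ω
  have hK : ∀ x ∈ box 3 n,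
      minOpenCutIn (↑(box 3 (2 * n)) : Set (Site 3))
        {a | a ∈ box 3 n ∧ ω ∈ openConnIn (↑(box 3 (2 * n)) : Set (Site 3)) x a}
        (↑(innerBoundary (zdGraph 3) (box 3 (2 * n))) : Set (Site 3)) ω ≤ K' :=
    fun x hx => not_lt.1 fun h => hno ⟨x, hx, h⟩
  have hcut := AnnulusSplit.minCut_le_of_reps_of_throughput hE hK
  obtain ⟨T, hTcard, hTcut⟩ := minOpenCutIn_le_iff.1 hcut
  exact hbudget ⟨T, hTcard, fun ⟨x, hx, y, hy, hxy⟩ => hTcut ⟨x, Finset.mem_coe.2 hx, y, Finset.mem_coe.2 hy, hxy⟩⟩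

/-! ## Composition (kernel-checked, no `sorry` of its own) -/

/-- **GLUE `stub₁ → stub₂ → BudgetTightness`** (`k = K`, `l = 2`, constant `c/2`): along stmt-4444's subsequence
`P(E_M) ≥ c`; stub 2 at `(M, c/2)` gives `K` with `P(E_M ∩ {budget > K}) ≤ c/2` eventually; and
`E_M ⊆ {budget ≤ K} ∪ (E_M ∩ {budget > K})`. Conclusion = the body of `BudgetTightness` written out (so that only
`BudgetTightness_of` concludes the crux by NAME); proof identical to the to-be-landed `BudgetTightness_of_subs`. -/
theorem line_composition
    (hNP : ∃ (M : ℕ) (c : ℝ), 0 < c ∧ ∃ᶠ n : ℕ in Filter.atTop, c ≤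
      (bondPercolation (zdGraph 3) (criticalProbI 3)).real
        {ω | ¬ ∃ x : Fin (M + 1) → Site 3, (∀ i, x i ∈ box 3 n) ∧
          (∀ i, ∃ y ∈ innerBoundary (zdGraph 3) (box 3 (2 * n)),
            ω ∈ openConnIn ↑(box 3 (2 * n)) (x i) y) ∧
          ∀ i j, i ≠ j → ω ∉ openConnIn ↑(box 3 (2 * n)) (x i) (x j)})
    (hT : ∀ (M : ℕ) (ε : ℝ), 0 < ε → ∃ K : ℕ, ∀ᶠ n : ℕ in Filter.atTop,
      (bondPercolation (zdGraph 3) (criticalProbI 3)).real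
        {ω | (¬ ∃ x : Fin (M + 1) → Site 3, (∀ i, x i ∈ box 3 n) ∧
            (∀ i, ∃ y ∈ innerBoundary (zdGraph 3) (box 3 (2 * n)),
              ω ∈ openConnIn ↑(box 3 (2 * n)) (x i) y) ∧
            ∀ i j, i ≠ j → ω ∉ openConnIn ↑(box 3 (2 * n)) (x i) (x j)) ∧
          ¬ ∃ S : Finset (Sym2 (Site 3)), S.card ≤ K ∧
            ¬ ∃ x ∈ box 3 n, ∃ y ∈ innerBoundary (zdGraph 3) (box 3 (2 * n)),
              (ω \ ↑S) ∈ openConnIn ↑(box 3 (2 * n)) x y} ≤ ε) :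
    ∃ (k l : ℕ) (c : ℝ), 2 ≤ l ∧ 0 < c ∧ ∀ N : ℕ, ∃ n : ℕ, N ≤ n ∧ c ≤
      (bondPercolation (zdGraph 3) (criticalProbI 3)).real
        {ω | ∃ S : Finset (Sym2 (Site 3)), S.card ≤ k ∧
          ¬ ∃ x ∈ box 3 n, ∃ y ∈ innerBoundary (zdGraph 3) (box 3 (l * n)),
            (ω \ ↑S) ∈ openConnIn ↑(box 3 (l * n)) x y} := by
  obtain ⟨M, c, hc, hfreq⟩ := hNP
  obtain ⟨K, hK⟩ := hT M (c / 2) (by positivity)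
  refine ⟨K, 2, c / 2, le_rfl, by positivity, fun N => ?_⟩
  obtain ⟨n, hcn, hNn, hbad⟩ := (hfreq.and_eventually ((eventually_ge_atTop N).and hK)).exists
  refine ⟨n, hNn, ?_⟩
  have hsub :
      {ω : BondConfig (Site 3) | ¬ ∃ x : Fin (M + 1) → Site 3, (∀ i, x i ∈ box 3 n) ∧
          (∀ i, ∃ y ∈ innerBoundary (zdGraph 3) (box 3 (2 * n)),
            ω ∈ openConnIn ↑(box 3 (2 * n)) (x i) y) ∧
          ∀ i j, i ≠ j → ω ∉ openConnIn ↑(box 3 (2 * n)) (x i) (x j)} ⊆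
      {ω | ∃ S : Finset (Sym2 (Site 3)), S.card ≤ K ∧
          ¬ ∃ x ∈ box 3 n, ∃ y ∈ innerBoundary (zdGraph 3) (box 3 (2 * n)),
            (ω \ ↑S) ∈ openConnIn ↑(box 3 (2 * n)) x y} ∪
      {ω | (¬ ∃ x : Fin (M + 1) → Site 3, (∀ i, x i ∈ box 3 n) ∧
            (∀ i, ∃ y ∈ innerBoundary (zdGraph 3) (box 3 (2 * n)),
              ω ∈ openConnIn ↑(box 3 (2 * n)) (x i) y) ∧
            ∀ i j, i ≠ j → ω ∉ openConnIn ↑(box 3 (2 * n)) (x i) (x j)) ∧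
          ¬ ∃ S : Finset (Sym2 (Site 3)), S.card ≤ K ∧
            ¬ ∃ x ∈ box 3 n, ∃ y ∈ innerBoundary (zdGraph 3) (box 3 (2 * n)),
              (ω \ ↑S) ∈ openConnIn ↑(box 3 (2 * n)) x y} := by
    intro ω hω
    by_cases hG : ω ∈ {ω : BondConfig (Site 3) | ∃ S : Finset (Sym2 (Site 3)), S.card ≤ K ∧
          ¬ ∃ x ∈ box 3 n, ∃ y ∈ innerBoundary (zdGraph 3) (box 3 (2 * n)),
            (ω \ ↑S) ∈ openConnIn ↑(box 3 (2 * n)) x y}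
    · exact Or.inl hG
    · exact Or.inr ⟨hω, hG⟩
  have h1 := (measureReal_mono hsub
    (measure_ne_top (bondPercolation (zdGraph 3) (criticalProbI 3)) _)).trans
    (measureReal_union_le _ _)
  linarith

/-- **The line concludes the crux BY NAME** from the two registered stubs; no `sorry` of its own (its only non-standard axiom
is the `sorryAx` of the two stubs). -/
theorem BudgetTightness_of :
    Summit.CriticalPhenomena.PercolationContinuityZ3.Theses.PercBudgetLadder.BudgetTightness :=
  line_composition stub_nonProliferation stub_fewClustersCutTight

end Summit.CriticalPhenomena.PercolationContinuityZ3.Cruxes.BudgetTightness.LineFewClustersSplit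

end
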